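import Summits.CriticalPhenomena.PercolationContinuityZ3.Theorems.Transplant.FKConnectivityAllQForestAdjacentNoSqSplit
import Summits.CriticalPhenomena.PercolationContinuityZ3.Theorems.Transplant.FKConnectivityAllQForestAdjacentDegThree
import Summits.CriticalPhenomena.PercolationContinuityZ3.Theorems.Transplant.FKConnectivityAllQArborealContraction
import Literature.Probability.LatticeModels.RandomClusterFKG
import HarnessLib

/-!
# Quotient monotonicity contains the square-free adjacent forest node

builds on p205010 (kernel theorem, internal audit signed; external expert review pending).  No definitions, no named facts, no sorries;
standard axioms.

Memo bschramm/FROM-fk-1-g20-SEPARATOR-EXCHANGE.md §3d (READ FIRST).  The quotient-monotonicity family (QS-K) used as hypothesis `hQ` in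
`…ForestQuotientMono` / `…PathGadgetSignFact` is, after `A acyclic in G/yv ⟺ A + yv acyclic`, ADJACENT-SET (star) NEGATIVE CORRELATION
for the uniform ordered 2-forest colouring, and its smallest instance (`S = {o}`, `T = {o, v}`, `K = ∅`) IS the node
`AdjForestRayleighNoSqOn V` on the split fibres: `#(Fo ∩ {e,f ∈ ω}, Fo) = #_{M}(FM{o,v,y}, Fo)` and `#(Fo ∩ {e ∈ ω}, Fo ∩ {f ∈ ω}) =
#_{M}(FM{o,v}, FM{o,y})` (`fibreCount_insert_two_both/one`), so (QS-K) ⇒ the node on EVERY fibre of `V`, with no separator at all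
(`adjForestRayleighNoSqOn_of_split` handles the non-split fibres).  This file records that implication, so that (QS-K) is read as a
STRENGTHENING of the node (pairs → adjacent stars), not as a weaker target.
* `sep_pair_iff`, `sep_triple_iff` — pairwise separation of two / three named points;
* `isForestCfg_insert_two_iff` — `ω + ov + oy ∈ Fo ⟺ ω ∈ FM{o,v,y}`;
* **`adjForestRayleighNoSqOn_of_quotientMono`** — (QS-K) on `V` ⇒ `AdjForestRayleighNoSqOn V`.
[cite: SempleWelsh2008, Conj. 1.1 (p. 2)] [cite: Linusson2011, Prop. 2.6] [cite: CibulkaHladkyLaCroixWagner2008, Thm. 1 (p. 2)]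
-/

noncomputable section

namespace Summit.CriticalPhenomena.PercolationContinuityZ3.Theorems

namespace FK

open Set SimpleGraph Literature.Probability.LatticeModels Literature.Probability.Percolation
open scoped Classical symmDiff

variable {V : Type*} [Fintype V]

section NodeOfQuotientMono

variable {ω : BondConfig V} {o v y : V}

omit [Fintype V] in
/-- Pairwise separation of two named points. [folklore] -/
theorem sep_pair_iff (hov : o ≠ v) :
    (∀ x ∈ ({o, v} : Set V), ∀ x' ∈ ({o, v} : Set V), (openGraph ω).Reachable x x' → x = x') ↔
      ¬ (openGraph ω).Reachable o v := by
  constructor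
  · intro h hr
    exact hov (h o (mem_insert _ _) v (mem_insert_of_mem _ rfl) hr)
  · intro h x hx x' hx' hr
    simp only [mem_insert_iff, mem_singleton_iff] at hx hx'
    rcases hx with rfl | rfl <;> rcases hx' with rfl | rfl
    · rfl
    · exact absurd hr h
    · exact absurd hr.symm h
    · rfl

omit [Fintype V] in
/-- Pairwise separation of three named points. [folklore] -/
theorem sep_triple_iff (hov : o ≠ v) (hoy : o ≠ y) (hvy : v ≠ y) :
    (∀ x ∈ ({y, o, v} : Set V), ∀ x' ∈ ({y, o, v} : Set V), (openGraph ω).Reachable x x' → x = x') ↔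
      (¬ (openGraph ω).Reachable o v ∧ ¬ (openGraph ω).Reachable o y ∧ ¬ (openGraph ω).Reachable v y) := by
  constructor
  · intro h
    refine ⟨fun hr => hov (h o ?_ v ?_ hr), fun hr => hoy (h o ?_ y ?_ hr), fun hr => hvy (h v ?_ y ?_ hr)⟩ <;>
      simp only [mem_insert_iff, mem_singleton_iff, true_or, or_true]
  · rintro ⟨h1, h2, h3⟩ x hx x' hx' hr
    simp only [mem_insert_iff, mem_singleton_iff] at hx hx'
    rcases hx with rfl | rfl | rfl <;> rcases hx' with rfl | rfl | rfl
    · rfl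
    · exact absurd hr.symm h2
    · exact absurd hr.symm h3
    · exact absurd hr h2
    · rfl
    · exact absurd hr h1
    · exact absurd hr h3
    · exact absurd hr.symm h1
    · rfl

omit [Fintype V] in
/-- **Two pinned pairs at `o`**: for `ov, oy ∉ ω` and `o, v, y` distinct, `ω + ov + oy` is a forest configuration iff `ω` is one in
which `o, v, y` are pairwise separated. [cite: Grimmett2006, §1.5 (p. 13)] -/
theorem isForestCfg_insert_two_iff (hov : o ≠ v) (hoy : o ≠ y) (hvy : v ≠ y) (he : s(o, v) ∉ ω) (hf : s(o, y) ∉ ω) :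
    IsForestCfg (insert s(o, y) (insert s(o, v) ω)) ↔
      (IsForestCfg ω ∧ ¬ (openGraph ω).Reachable o v ∧ ¬ (openGraph ω).Reachable o y ∧ ¬ (openGraph ω).Reachable v y) := by
  have hf' : s(o, y) ∉ insert s(o, v) ω := by
    rintro (h | h)
    · rcases Sym2.eq_iff.1 h with ⟨-, h2⟩ | ⟨h1, -⟩
      · exact hvy h2.symm
      · exact hov h1
    · exact hf h
  rw [isForestCfg_insert_iff hoy hf', isForestCfg_insert_iff hov he, openGraph_insert_eq_sup_edge]
  have hle : openGraph ω ≤ openGraph ω ⊔ edge o v := le_sup_left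
  have hadj : (openGraph ω ⊔ edge o v).Adj o v :=
    (sup_adj _ _ _ _).2 (Or.inr ((edge_adj _ _ _ _).2 ⟨Or.inl ⟨rfl, rfl⟩, hov⟩))
  constructor
  · rintro ⟨⟨hF, hnov⟩, hnoy⟩
    exact ⟨hF, hnov, fun h => hnoy (h.mono hle), fun h => hnoy (hadj.reachable.trans (h.mono hle))⟩
  · rintro ⟨hF, h1, h2, h3⟩
    refine ⟨⟨hF, h1⟩, fun h => ?_⟩
    rcases reachable_sup_edge_imp _ o v h with h | ⟨-, h⟩ | ⟨h, -⟩
    · exact h2 h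
    · exact h3 h
    · exact h1 h

/-- **(QS-K) ⇒ the node on every fibre** (memo §3d READ FIRST): the instance `S = {o}`, `T = {o,v}`, `K = ∅` of the quotient-monotonicity
family is `#_{M}(Fo, FM{y,o,v}) ≤ #_{M}(FM{y,o}, FM{o,v})`, i.e. after `fibreCount_swap` and `fibreCount_insert_two_both / _one` the
split-fibre inequality of `AdjForestRayleighNoSqOn V`; `adjForestRayleighNoSqOn_of_split` does the rest.
[cite: SempleWelsh2008, Conj. 1.1 (p. 2)] [cite: Linusson2011, Prop. 2.6] [cite: CibulkaHladkyLaCroixWagner2008, Thm. 1 (p. 2)] -/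
theorem adjForestRayleighNoSqOn_of_quotientMono (FM : Set V → Set (BondConfig V))
    (hFM : ∀ (S : Set V) (ω : BondConfig V),
      ω ∈ FM S ↔ IsForestCfg ω ∧ ∀ x ∈ S, ∀ x' ∈ S, (openGraph ω).Reachable x x' → x = x')
    (hQ : ∀ (M' u' K : BondConfig V) (S T : Set V) (y' : V), Disjoint u' M' → K ⊆ M' → S ⊆ T → y' ∉ T →
      (∀ e ∈ K, ∀ x ∈ e, x ∈ T) →
      fibreCount M' u' (FM S ∩ {ω | K ⊆ ω}) (FM (insert y' T)) ≤ fibreCount M' u' (FM (insert y' S) ∩ {ω | K ⊆ ω}) (FM T)) :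
    AdjForestRayleighNoSqOn V := by
  refine adjForestRayleighNoSqOn_of_split fun M u₀ hd o v y hov hoy hvy heM hfM heu hfu => ?_
  have hef : s(o, v) ≠ s(o, y) := fun h => by
    rcases Sym2.eq_iff.1 h with ⟨-, h2⟩ | ⟨h1, -⟩
    · exact hvy h2
    · exact hoy h1
  rw [fibreCount_insert_two_both heM hfM, fibreCount_insert_two_one hef heM hfM]
  have key := hQ M u₀ ∅ {o} {o, v} y hd (empty_subset _) (singleton_subset_iff.2 (mem_insert _ _))
    (by simp only [mem_insert_iff, mem_singleton_iff, not_or]; exact ⟨fun h => hoy h.symm, fun h => hvy h.symm⟩)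
    (fun e he => absurd he (notMem_empty e))
  rw [fibreCount_swap M u₀ (FM {o} ∩ {ω | (∅ : BondConfig V) ⊆ ω}), fibreCount_swap M u₀ (FM (insert y {o}) ∩ _)] at key
  -- on the fibre `(M, u₀)` neither `e` nor `f` occurs; translate the events
  have hnot : ∀ ω : BondConfig V, ω \ M = u₀ → (s(o, v) ∉ ω ∧ s(o, y) ∉ ω) ∧ (s(o, v) ∉ ω ∆ M ∧ s(o, y) ∉ ω ∆ M) := by
    intro ω hω
    have h1 : ∀ g : Sym2 V, g ∉ M → g ∉ u₀ → g ∉ ω ∧ g ∉ ω ∆ M := by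
      intro g hgM hgu
      constructor
      · intro h
        have : g ∈ ω \ M := ⟨h, hgM⟩
        rw [hω] at this
        exact hgu this
      · intro h
        rcases Set.mem_symmDiff.1 h with h | h
        · have : g ∈ ω \ M := ⟨h.1, h.2⟩
          rw [hω] at this
          exact hgu this
        · exact hgM h.1
    exact ⟨⟨(h1 _ heM heu).1, (h1 _ hfM hfu).1⟩, (h1 _ heM heu).2, (h1 _ hfM hfu).2⟩
  refine le_trans (le_of_eq (fibreCount_congr_fibre M u₀ fun ω hω => ?_))
    (le_trans key (le_of_eq (fibreCount_congr_fibre M u₀ fun ω hω => ?_)))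
  · obtain ⟨⟨heω, hfω⟩, heω', hfω'⟩ := hnot ω hω
    simp only [mem_inter_iff, mem_setOf_eq, forestEv, hFM, empty_subset, and_true]
    rw [isForestCfg_insert_two_iff hov hoy hvy heω hfω, sep_triple_iff hov hoy hvy]
    constructor
    · rintro ⟨⟨-, hA⟩, -, hF'⟩
      exact ⟨hA, hF', fun x hx x' hx' _ => by rw [mem_singleton_iff.1 hx, mem_singleton_iff.1 hx']⟩
    · rintro ⟨hA, hF', -⟩
      exact ⟨⟨⟨heω, hfω⟩, hA⟩, ⟨heω', hfω'⟩, hF'⟩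
  · obtain ⟨⟨heω, hfω⟩, heω', hfω'⟩ := hnot ω hω
    simp only [mem_inter_iff, mem_setOf_eq, forestEv, hFM, empty_subset, and_true]
    rw [isForestCfg_insert_iff hov heω, isForestCfg_insert_iff hoy hfω', sep_pair_iff hov,
      sep_pair_iff (ω := ω ∆ M) (o := y) (v := o) (fun h => hoy h.symm)]
    constructor
    · rintro ⟨⟨hF, h1⟩, hF', h2⟩
      exact ⟨⟨⟨heω, hfω⟩, hF, h1⟩, ⟨heω', hfω'⟩, hF', fun h => h2 h.symm⟩
    · rintro ⟨⟨-, hF, h1⟩, -, hF', h2⟩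
      exact ⟨⟨hF, h1⟩, hF', fun h => h2 h.symm⟩

end NodeOfQuotientMono

end FK

end Summit.CriticalPhenomena.PercolationContinuityZ3.Theorems
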